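import Mathlib.Analysis.Calculus.Deriv.Mul
import Mathlib.Analysis.Calculus.Deriv.Comp
import Mathlib.Analysis.Calculus.FDeriv.Basic
import HarnessLib

/-!
# Route `EfficiencyFloor`, crux `MaximiserSetRigidity` (stmt-NavierStokesRegularity-25512), part (b), rotating case:
# the time derivative of the rotating self-similar orbit `u(s,x) = λ(s) R(s) m(λ(s) R(s)⁻¹ x)`

Helper file (`--supports stmt-NavierStokesRegularity-25512`), route-independent (Mathlib only). Fourth brick of the
orbit argument for the driftless rotating collapse Liouville theorem (L⁺_rot) (bricks 1–3: `…RotatingDrift`,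
`…OrbitBlowup`, `…OrbitL3`). Abstract chain rule: if `λ' = c′λ³`, `R' = −λ² R∘W`, `(R⁻¹)' = λ² R⁻¹∘W`
(`R(s) = exp(φ(s)W)` with `φ' = −λ²`, `W` skew), `R⁻¹` commutes with `W`, and `m` is differentiable at
`y = λ R⁻¹ x`, then
`∂ₛ[λ R m(λ R⁻¹ x)] = λ³ R [c′(m(y) + Dm(y)y) + (Dm(y)(Wy) − W m(y))]`
— exactly `λ³ R` applied to the right-hand side of the relative-equilibrium profile equation
`νΔm − (m·∇)m − ∇π = ((Wx)·∇)m − Wm + c′(m + (x·∇)m)` of stmt-25512 (b) at `y`; the spatial terms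
`(u·∇)u`, `νΔu`, `∇p` of the orbit are `λ³ R` times the left-hand side at `y` (rotation covariance, tree
`IsometryInvariance` + `LeraySelfSimilarCalculus`), so the orbit solves Navier–Stokes.

* `hasDerivAt_rotatingOrbit` — the displayed formula (any real normed space `E`).

HONEST FRAMING: a calculus brick; (L⁺_rot), stmt-25512, `ProductionEfficiencyDecay` and Navier–Stokes regularity
stay OPEN; no summit statement is proved. [folklore]
-/

noncomputable section

-- the problem directory repeats the summit name (`NavierStokesRegularity/NavierStokesRegularity`)
set_option linter.dupNamespace false

namespace Summit.NavierStokesRegularity.NavierStokesRegularity.Theorems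

namespace MaximiserSetRigidity

namespace RotatingOrbit

open Set Function

variable {E : Type*} [NormedAddCommGroup E] [NormedSpace ℝ E]

/-- **Time derivative of the rotating self-similar orbit.** With `λ' = c′λ³`, `R' = −λ²·R∘W`,
`(R⁻¹)' = λ²·R⁻¹∘W` at `s`, `R⁻¹(s)` commuting with `W`, `λ(s) ≠ 0` and `m` differentiable at `y = λ(s)R⁻¹(s)x`:
`∂ₛ[λ R m(λ R⁻¹ x)](s) = λ³ R [c′(m(y) + Dm(y)y) + (Dm(y)(Wy) − W m(y))]`. [folklore] -/
theorem hasDerivAt_rotatingOrbit {lam : ℝ → ℝ} {Rc Rc' : ℝ → (E →L[ℝ] E)} {W : E →L[ℝ] E}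
    {m : E → E} {c' s : ℝ} (x y : E)
    (hlam : HasDerivAt lam (c' * lam s ^ 3) s) (hlam0 : lam s ≠ 0)
    (hRc : HasDerivAt Rc (-(lam s ^ 2) • (Rc s).comp W) s)
    (hRc' : HasDerivAt Rc' ((lam s ^ 2) • (Rc' s).comp W) s)
    (hcomm : ∀ v, Rc' s (W v) = W (Rc' s v))
    (hy : lam s • Rc' s x = y) (hm : DifferentiableAt ℝ m y) :
    HasDerivAt (fun σ => lam σ • Rc σ (m (lam σ • Rc' σ x)))
      (lam s ^ 3 • Rc s (c' • (m y + fderiv ℝ m y y) + (fderiv ℝ m y (W y) - W (m y)))) s := by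
  -- the inner point `z(σ) = λ(σ) R⁻¹(σ) x`
  have hz : HasDerivAt (fun σ => lam σ • Rc' σ x)
      (lam s • (((lam s ^ 2) • (Rc' s).comp W) x + Rc' s 0) + (c' * lam s ^ 3) • Rc' s x) s :=
    hlam.smul (hRc'.clm_apply (hasDerivAt_const s x))
  have hzs : (fun σ => lam σ • Rc' σ x) s = y := by simp only [hy]
  -- `m` along the inner point
  have hm' : HasFDerivAt m (fderiv ℝ m y) ((fun σ => lam σ • Rc' σ x) s) := by
    rw [hzs]; exact hm.hasFDerivAt
  have hn : HasDerivAt (fun σ => m (lam σ • Rc' σ x))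
      (fderiv ℝ m y (lam s • (((lam s ^ 2) • (Rc' s).comp W) x + Rc' s 0) + (c' * lam s ^ 3) • Rc' s x)) s :=
    hm'.comp_hasDerivAt s hz
  -- the rotation applied to it
  have hq : HasDerivAt (fun σ => Rc σ (m (lam σ • Rc' σ x)))
      ((-(lam s ^ 2) • (Rc s).comp W) (m (lam s • Rc' s x)) +
        Rc s (fderiv ℝ m y (lam s • (((lam s ^ 2) • (Rc' s).comp W) x + Rc' s 0) +
          (c' * lam s ^ 3) • Rc' s x))) s :=
    hRc.clm_apply hn
  -- the amplitude
  have hu := hlam.smul hq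
  refine hu.congr_deriv ?_
  -- algebra
  have hx : Rc' s x = (lam s)⁻¹ • y := by
    rw [← hy, smul_smul, inv_mul_cancel₀ hlam0, one_smul]
  simp only [hy]
  simp only [map_zero, add_zero, FunLike.coe_smul, FunLike.coe_neg, Pi.smul_apply,
    Pi.neg_apply, ContinuousLinearMap.comp_apply, hcomm, hx, map_smul, map_add, map_sub, smul_add, smul_sub,
    smul_neg, smul_smul, neg_smul]
  have h3 : lam s * (lam s ^ 2 * (lam s)⁻¹) = lam s ^ 2 := by field_simp
  have h4 : lam s * (c' * lam s ^ 3 * (lam s)⁻¹) = lam s ^ 3 * c' := by field_simp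
  have h5 : lam s * lam s ^ 2 = lam s ^ 3 := by ring
  rw [h3, h4, h5]
  module

end RotatingOrbit

end MaximiserSetRigidity

end Summit.NavierStokesRegularity.NavierStokesRegularity.Theorems

end
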